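import Summits.BirchSwinnertonDyer.BirchSwinnertonDyer.Theorems.UniversalToricDescentSigmaCongruenceAtThreeIffInvariantPair
import HarnessLib

/-!
# Node `TransferWitnessAudit` (crux-ideate g18 on A = `SigmaCongruenceAtThree`, stmt-BirchSwinnertonDyer-27120)

Memo `NodeTransferWitnessAudit.md` (same directory).  D-0171 node: a compiling Cruxes file, no `sorry`; every piece
tagged; the compositions conclude A BY NAME (`sigmaCongruenceAtThree_of_sqrtToricFunctional`,
`sigmaCongruenceAtThree_of_divisibleSquareRootPair`).

## 0. One paragraph — what this node AUDITS and what it proves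

The pool's three typed TRANSFER statements for A — the line's hardest stub F (`stub_sqrtToricFunctional`, "ONE
additive square-root toric functional `Θ : ℤ^ℕ →+ R₀⟦T⟧`"), g9's F♭ (`CongruentSquareRootPair`) and g10's F𝔪
(`ClassicalMomentSquareRootPair`) — are tagged in every memo since g9 as «STRONGER than A · TRANSFER · UNDECIDED;
COSTUME: none», on the ground that "both square roots are values of ONE additive `Θ` (no free unit)" (line card,
dead line (iii)) and that "no cheap proof of F𝔪 bypasses the mathematics" (g10 memo §2).  This node runs the planner's
degenerate-witness pass (crux-typing checklist 4c (iv)) on the ∃-WITNESSES of these statements and records, in the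
kernel, that the functional is FREE:

* §1 `exists_addMonoidHom_apply_eq` (PROVED, pure algebra): for ANY two vectors `g, g′ ∈ ℤ^ℕ` with a common coordinate
  equal to `1` and ANY two series `Y, Y′ ∈ R₀⟦T⟧`, an additive `Θ : ℤ^ℕ →+ R₀⟦T⟧` with `Θ g = Y`, `Θ g′ = Y′` EXISTS as soon
  as `3^k ∣ Y − Y′` for every `k` with `3^k ∣ g − g′` coordinatewise (two coordinate projections suffice; the converse
  `forall_exists_of_addMonoidHom` is one line).  So "ONE additive functional evaluated on `g_E, g_{E′}`" constrains
  NOTHING beyond the divisibility of `Y − Y′` to the depth of the `q`-expansion congruence.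
* §2 `sqrtToricFunctional_iff_divisibleSquareRootPair` (PROVED): stub F ⟺ F♭^{div} (`DivisibleSquareRootPair`: F♭ with
  its `mod 𝔪` clause replaced by "`3^k ∣ Y − Y′` whenever `3^k` divides every depleted coefficient difference"), on A's
  own binders, BOTH directions.  The functional has left the statement: F is F♭ at the `3`-adic depth
  `k_Σ = v₃(gcd_n (a_n(E) − a_n(E′)))` of the depleted congruence (`k_Σ = 1` unless `E ≡ E′ mod 9` on depleted
  coefficients).
* §2b `frame_eq_of_isUnit_mul` (PROVED): (wild)/(twin) determine their square root `Y` only up to a unit of `R₀⟦T⟧`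
  (`w ↦ w·s⁻²` absorbs any unit `s`), so F♭'s `mod 𝔪` clause compares two series that are free up to units.
* §3 `congruentSquareRootPair_of_divisible` (PROVED): F♭^{div} ∧ H (the line's Hecke-congruence stub, WEAKER than A)
  ⟹ F♭; with g9's F♭ ⟹ A (copied, PROVED) the line's deciding composition is re-factored THROUGH the functional-free
  F♭: `sigmaCongruenceAtThree_of_sqrtToricFunctional : hB → H → F → A` = `hB → H → (F ⟺ F♭^{div}) → F♭ → A`.

Consequences (memo §2–§4, paper where marked): (a) F ≡ F♭^{div} (kernel); (b) F♭ ≡ A ∧ Sq_E ∧ Sq_{E′} modulo `hB`,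
the DVR property of `R₀` and square roots in `k⟦T⟧` (paper: from A's λ-identity the two depleted frames are congruent
up to a unit — tree `exists_isUnit_sigmaCongruence_iff_normProfile` —, and two square roots of unit·congruent μ-free
series are congruent up to a unit of `k⟦T⟧ˣ = (k⟦T⟧ˣ)²`, absorbed into `w`), where Sq_E := "the depleted wild frame
`𝓛·Π_E(e)` is const·unit·(square in `R₀⟦T⟧`)" is a fact about ONE frame, independent of the `E ↔ E′` comparison;
(c) F𝔪 ≡ F♭ (paper: Zagier's realisation of an arbitrary `δ`-jet by a function holomorphic near `τ₀` makes
`IsKatzMomentSeries` satisfiable by junk `F, F′, H` for the junk series `Φ = 1, Φ′ = 1 + 3T, Ψ = −T`, and the free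
`R₀`-linear assembly `𝒜 x := x₀·Y + x₁·(Y′ − Y)/3` then delivers any F♭-pair).  Hence NONE of F, F♭, F𝔪 is a
DECOMPOSITION of A: each is A conjoined with frame-squareness, wearing a functional/moment vocabulary whose witnesses
are free.  The vocabulary becomes load-bearing only when the witnesses are PINNED (memo §4, the corrected S2 spec:
`Θ` pinned by `∃!` on the whole integral lattice `S₂(Γ₀(L_Σ); ℤ)` through CM moments at pinned Heegner data with a
UNIT `Ω_p`, AND the assembly `𝒜` pinned as the explicit class sum — a free `𝒜` re-opens the same door).

Pieces and tags (D-0171): §1 support · PROVED · WEAKER (pure algebra); F (`SqrtToricFunctional`, line stub, copied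
verbatim) ≡ F♭^{div} (`DivisibleSquareRootPair`) · kernel · both TRANSFER-IN-NAME-ONLY = «A ∧ Sq» (COSTUME-ADJACENT:
not a restatement of A — strictly stronger by Sq — but not a decomposition either); F♭ (`CongruentSquareRootPair`, g9,
copied verbatim) ⟸ F♭^{div} ∧ H · kernel; H (`HeckeCongruenceDepleted`, line stub, copied) WEAKER · ATTACKABLE (M);
compositions to A BY NAME · PROVED.  Leaves: Sq_E (wild depleted frame is const·unit·square) · UNDECIDED ·
ATTACKABLE only through the pinned port (it IS the wild Waldspurger shape W_E of g10 once `𝒜Φ` is pinned) · BARRIER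
for every un-pinned typing (this file); KI/LIN pinned (memo §4) · IDEA-NEEDED → typed spec given, not yet elaborated
(definition-sized: Heegner points as elements of `ℍ`, Frobenius substitutions for `𝒜`).
No Lean object of the line or of g9/g10 is modified; Cruxes modules are not built, so their statements are COPIED
verbatim with attribution (F: `Lines/sqrt_toric_functional.lean` ll. 101–152; H: ll. 77–81; F♭ and §4 of
`NodeClassicalMomentAvatar.lean` = g9 `NodeHeckeDualElement.lean` §2, §4).
-/

set_option autoImplicit false
-- `…BirchSwinnertonDyer.BirchSwinnertonDyer.Cruxes…` is the problem's mandated namespace (D-0017).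
set_option linter.dupNamespace false

noncomputable section

open scoped Classical

namespace Summit.BirchSwinnertonDyer.BirchSwinnertonDyer.Cruxes.SigmaCongruenceAtThree.TransferWitnessAudit

open NumberField IsDedekindDomain
open Literature.NumberTheory.EllipticCurves Literature.NumberTheory.EllipticCurves.GreenbergVatsal2000
  Summit.BirchSwinnertonDyer.Rank1Residual.X11b
  Summit.BirchSwinnertonDyer.BirchSwinnertonDyer.Theorems.UniversalToricDescentNormProfile
  Summit.BirchSwinnertonDyer.BirchSwinnertonDyer.Theorems.UniversalToricDescentAcEulerFactor
  Summit.BirchSwinnertonDyer.BirchSwinnertonDyer.Theorems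
  Summit.BirchSwinnertonDyer.BirchSwinnertonDyer.Theses.UniversalToricDescent

/-! ### §1 The free-functional lemma (PROVED, pure algebra): an additive functional on `ℤ^ℕ` tested on two vectors
is no constraint beyond the divisibility of the difference of its two values -/

/-- `‖3‖ < 1` in `ℂ₃` (copied from the line, §2). [folklore] -/
theorem norm_three_lt_one : ‖((3 : ℕ) : ℂ_[3])‖ < 1 := by
  haveI : Fact (Nat.Prime 3) := ⟨Nat.prime_three⟩
  have h : ‖((3 : ℕ) : ℂ_[3])‖ = ‖((3 : ℕ) : ℚ_[3])‖ := by
    rw [← map_natCast (algebraMap ℚ_[3] ℂ_[3]) 3, norm_algebraMap']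
  rw [h]
  exact Padic.norm_p_lt_one

/-- The constant `3` of `R₀⟦T⟧` is `C 3`. [folklore] -/
theorem three_eq_C : (3 : UnrSeries 3) = PowerSeries.C (3 : unrIntegers 3) :=
  (map_ofNat (PowerSeries.C (R := unrIntegers 3)) 3).symm

/-- `‖3 · z‖ < 1` for `z ∈ R₀`. [folklore] -/
theorem norm_three_mul_lt_one (z : unrIntegers 3) : ‖(((3 : unrIntegers 3) * z : unrIntegers 3) : ℂ_[3])‖ < 1 := by
  have h3 : ((3 : unrIntegers 3) : ℂ_[3]) = ((3 : ℕ) : ℂ_[3]) := by push_cast; rfl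
  rw [Subring.coe_mul, norm_mul, h3]
  exact mul_lt_one_of_nonneg_of_lt_one_left (norm_nonneg _) norm_three_lt_one
    (Halves.norm_coe_unrIntegers_le_one 3 z)

/-- A series divisible by every power of `3` in `R₀⟦T⟧` is `0` (`‖3^k z‖ ≤ 3^{-k}`). [folklore] -/
theorem eq_zero_of_forall_exists_eq_pow_mul {D : UnrSeries 3}
    (h : ∀ k : ℕ, ∃ Z : UnrSeries 3, D = (3 : UnrSeries 3) ^ k * Z) : D = 0 := by
  ext i
  rw [map_zero]
  by_contra hne
  have hpos : 0 < ‖((PowerSeries.coeff i D : unrIntegers 3) : ℂ_[3])‖ := by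
    rw [norm_pos_iff]
    exact_mod_cast hne
  obtain ⟨k, hk⟩ := exists_pow_lt_of_lt_one hpos norm_three_lt_one
  obtain ⟨Z, hZ⟩ := h k
  have hcoeff : PowerSeries.coeff i D = (3 : unrIntegers 3) ^ k * PowerSeries.coeff i Z := by
    rw [hZ, three_eq_C, ← map_pow, PowerSeries.coeff_C_mul]
  have h3 : ((3 : unrIntegers 3) : ℂ_[3]) = ((3 : ℕ) : ℂ_[3]) := by push_cast; rfl
  have hle : ‖((PowerSeries.coeff i D : unrIntegers 3) : ℂ_[3])‖ ≤ ‖((3 : ℕ) : ℂ_[3])‖ ^ k := by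
    rw [hcoeff, Subring.coe_mul, Subring.coe_pow, norm_mul, norm_pow, h3]
    exact mul_le_of_le_one_right (pow_nonneg (norm_nonneg _) _) (Halves.norm_coe_unrIntegers_le_one 3 _)
  exact absurd (lt_of_lt_of_le hk hle) (lt_irrefl _)

/-- The easy direction: an additive `Θ` transports coordinatewise divisibility `3^k ∣ g − g′` to `3^k ∣ Θ g − Θ g′`.
[folklore] -/
theorem forall_exists_of_addMonoidHom (Θ : (ℕ → ℤ) →+ UnrSeries 3) (g g' : ℕ → ℤ) (k : ℕ)
    (h : ∀ n : ℕ, (3 : ℤ) ^ k ∣ g n - g' n) :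
    ∃ Z : UnrSeries 3, Θ g - Θ g' = (3 : UnrSeries 3) ^ k * Z := by
  choose x hx using h
  refine ⟨Θ x, ?_⟩
  have hg : g = g' + ((3 : ℤ) ^ k) • x := by
    funext n
    simp only [Pi.add_apply, Pi.smul_apply, smul_eq_mul, ← hx n]
    ring
  rw [hg, map_add, map_zsmul, add_sub_cancel_left, zsmul_eq_mul]
  push_cast
  rfl

/-- **The free-functional lemma.**  Given two integer vectors `g, g′ : ℕ → ℤ` with `g n₁ = g′ n₁ = 1` for some
coordinate `n₁`, and two series `Y, Y′ ∈ R₀⟦T⟧` such that `3^k ∣ Y − Y′` for every `k` for which `3^k` divides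
`g − g′` coordinatewise, there is an ADDITIVE `Θ : (ℕ → ℤ) →+ R₀⟦T⟧` with `Θ g = Y` and `Θ g′ = Y′`.  Construction:
`Θ x := x(n₁)·Y + (x(n₀) − g(n₀)x(n₁))·d⁻¹·(Y′ − Y)/3^k` where `n₀` minimises `v₃(g(n) − g′(n))`, `g(n₀) − g′(n₀) =
3^k d`, `3 ∤ d` (so `d ∈ ℤ₃ˣ ⊂ R₀ˣ`); if `g = g′` then `Y = Y′` (divisible by every `3^k`) and `Θ x := x(n₁)·Y`.
This is the degenerate-witness pass on the line's stub F: its "ONE additive functional" is free. [folklore] -/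
theorem exists_addMonoidHom_apply_eq {g g' : ℕ → ℤ} {n₁ : ℕ} (h1 : g n₁ = 1) (h1' : g' n₁ = 1)
    {Y Y' : UnrSeries 3}
    (hdiv : ∀ k : ℕ, (∀ n : ℕ, (3 : ℤ) ^ k ∣ g n - g' n) →
      ∃ Z : UnrSeries 3, Y - Y' = (3 : UnrSeries 3) ^ k * Z) :
    ∃ Θ : (ℕ → ℤ) →+ UnrSeries 3, Θ g = Y ∧ Θ g' = Y' := by
  haveI : Fact (Nat.Prime 3) := ⟨Nat.prime_three⟩
  by_cases hgg : ∀ n, g n = g' n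
  · -- degenerate case `g = g′`: then `Y = Y′`
    have hY : Y = Y' := by
      refine sub_eq_zero.mp (eq_zero_of_forall_exists_eq_pow_mul fun k ↦ hdiv k fun n ↦ ?_)
      rw [hgg n, sub_self]
      exact dvd_zero _
    refine ⟨AddMonoidHom.mk' (fun x ↦ ((x n₁ : ℤ) : UnrSeries 3) * Y) (fun x y ↦ ?_), ?_, ?_⟩
    · simp only [Pi.add_apply, Int.cast_add]
      ring
    · simp [h1]
    · simp [h1', hY]
  · push Not at hgg
    have hex : ∃ m : ℕ, ∃ n : ℕ, g n ≠ g' n ∧ padicValInt 3 (g n - g' n) = m := by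
      obtain ⟨n, hn⟩ := hgg
      exact ⟨_, n, hn, rfl⟩
    obtain ⟨n₀, hn₀, hval⟩ := Nat.find_spec hex
    set k : ℕ := Nat.find hex with hk
    have hall : ∀ n : ℕ, (3 : ℤ) ^ k ∣ g n - g' n := by
      intro n
      by_cases hn : g n = g' n
      · rw [hn, sub_self]
        exact dvd_zero _
      · have hle : k ≤ padicValInt 3 (g n - g' n) := Nat.find_min' hex ⟨n, hn, rfl⟩
        have := (padicValInt_dvd_iff (p := 3) k (g n - g' n)).mpr (Or.inr hle)
        exact_mod_cast this
    obtain ⟨Z, hZ⟩ := hdiv k hall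
    obtain ⟨d, hd⟩ := hall n₀
    have hd3 : ¬ (3 : ℤ) ∣ d := by
      intro h3
      have h' : ((3 : ℕ) : ℤ) ^ (k + 1) ∣ g n₀ - g' n₀ := by
        rw [hd, pow_succ]
        exact_mod_cast mul_dvd_mul_left ((3 : ℤ) ^ k) h3
      rcases (padicValInt_dvd_iff (p := 3) (k + 1) (g n₀ - g' n₀)).mp h' with h0 | hle
      · exact hn₀ (sub_eq_zero.mp h0)
      · rw [hval] at hle
        omega
    have hu : IsUnit ((d : ℤ) : ℤ_[3]) := by
      rw [PadicInt.isUnit_iff]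
      refine le_antisymm (PadicInt.norm_le_one _) ?_
      by_contra hlt
      push Not at hlt
      exact hd3 ((PadicInt.norm_int_lt_one_iff_dvd d).mp hlt)
    obtain ⟨u, hu'⟩ := hu
    -- the correction series `V := u⁻¹ · Z`, so that `(g n₀ − g′ n₀) · V = 3^k d · u⁻¹ Z = 3^k Z = Y − Y′`
    set V : UnrSeries 3 := PowerSeries.C (Halves.toUnr 3 (↑u⁻¹ : ℤ_[3])) * Z with hV
    have hdC : ((d : ℤ) : UnrSeries 3) * PowerSeries.C (Halves.toUnr 3 (↑u⁻¹ : ℤ_[3])) = 1 := by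
      rw [← map_intCast (PowerSeries.C (R := unrIntegers 3)) d, ← map_mul, ← map_intCast (Halves.toUnr 3) d,
        ← map_mul, ← hu', Units.mul_inv, map_one, map_one]
    have hkey : ((g n₀ - g' n₀ : ℤ) : UnrSeries 3) * V = Y - Y' := by
      rw [hd, hZ, hV]
      push_cast
      calc (3 : UnrSeries 3) ^ k * ((d : ℤ) : UnrSeries 3) *
            (PowerSeries.C (Halves.toUnr 3 (↑u⁻¹ : ℤ_[3])) * Z)
          = (3 : UnrSeries 3) ^ k *
              (((d : ℤ) : UnrSeries 3) * PowerSeries.C (Halves.toUnr 3 (↑u⁻¹ : ℤ_[3]))) * Z := by ring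
        _ = (3 : UnrSeries 3) ^ k * Z := by rw [hdC, mul_one]
    refine ⟨AddMonoidHom.mk' (fun x ↦ ((x n₁ : ℤ) : UnrSeries 3) * Y +
        (((x n₀ : ℤ) : UnrSeries 3) - ((g n₀ : ℤ) : UnrSeries 3) * ((x n₁ : ℤ) : UnrSeries 3)) * V)
      (fun x y ↦ ?_), ?_, ?_⟩
    · simp only [Pi.add_apply, Int.cast_add]
      ring
    · simp only [AddMonoidHom.mk'_apply, h1, Int.cast_one, one_mul, mul_one, sub_self, zero_mul, add_zero]
    · simp only [AddMonoidHom.mk'_apply, h1', Int.cast_one, one_mul, mul_one]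
      have hneg : ((g' n₀ : ℤ) : UnrSeries 3) - ((g n₀ : ℤ) : UnrSeries 3) =
          -(((g n₀ - g' n₀ : ℤ) : UnrSeries 3)) := by
        push_cast
        ring
      rw [hneg, neg_mul, hkey]
      ring

/-! ### §2 Stub F (the line, copied verbatim) and F♭^{div}; the equivalence F ⟺ F♭^{div} (PROVED, both directions) -/

/-- **F = the line's stub `stub_sqrtToricFunctional`** (`Lines/sqrt_toric_functional.lean` ll. 101–152, statement copied
VERBATIM as a `Prop`; the Lines module is not built, so it cannot be imported): on A's binders, ONE additive
`Θ : (ℕ → ℤ) →+ R₀⟦T⟧`, exponents `e`, (wild) for `Θ g_E`, (twin) for `Θ g_{E′}`, (μ′) for `Θ g_{E′}`, where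
`g_E(n) = 𝟙_{(n,3NN′)=1}·a_n(E)`.  Tag (this node): ≡ F♭^{div} (`sqrtToricFunctional_iff_divisibleSquareRootPair`) — the
functional is a FREE witness. [cite: BertoliniDarmonPrasanna2013, Thm. 5.13] [cite: GreenbergVatsal2000, Thm. (1.5)] -/
def SqrtToricFunctional : Prop :=
      ∀ (W : WeierstrassCurve ℚ) [W.IsElliptic] [W.IsGloballyMinimal] (W' : WeierstrassCurve ℚ) [W'.IsElliptic]
      [W'.IsGloballyMinimal] (N N' : ℕ) [NeZero N] [NeZero N'] (K : Type) [Field K] [NumberField K] (Dt :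
      Literature.NumberTheory.EllipticCurves.ModularForms.ModularParametrizationData W N) (Dt' :
      Literature.NumberTheory.EllipticCurves.ModularForms.ModularParametrizationData W' N'),
      Summit.BirchSwinnertonDyer.Rank1Residual.Additive.ClassO6 W 3 → W.HasSurjectiveModNGaloisRep 3 →
      W.analyticRank = 1 → W.conductorNorm ℤ = N → Summit.BirchSwinnertonDyer.Rank1Residual.O6.ModPCongruent W' W
      3 → ¬ Literature.NumberTheory.EllipticCurves.Rank1Residual.Addv W' 3 → W'.conductorNorm ℤ = N' →
      Literature.NumberTheory.EllipticCurves.IsImaginaryQuadratic K →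
      Literature.NumberTheory.EllipticCurves.SatisfiesHeegnerHypothesis N K →
      Literature.NumberTheory.EllipticCurves.SatisfiesHeegnerHypothesis N' K → ∀ (κ :
      Literature.NumberTheory.EllipticCurves.ZpExtension K 3), κ.IsAnticyclotomic → ∀ (γ :
      Field.absoluteGaloisGroup K) [Fact (κ.IsTopGenerator γ)] (𝔭 : IsDedekindDomain.HeightOneSpectrum
      (NumberField.RingOfIntegers K)), ((3 : ℕ) : NumberField.RingOfIntegers K) ∈ 𝔭.asIdeal →
      𝔭.asIdeal.ramificationIdx (NumberField.RingOfIntegers ℚ) = 1 → 𝔭.asIdeal.inertiaDeg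
      (NumberField.RingOfIntegers ℚ) = 1 → ∀ (𝔭' : IsDedekindDomain.HeightOneSpectrum (NumberField.RingOfIntegers
      K)), ((3 : ℕ) : NumberField.RingOfIntegers K) ∈ 𝔭'.asIdeal → 𝔭' ≠ 𝔭 → ∀ (ι' : PadicAlgCl 3 ≃+* ℂ),
      Summit.BirchSwinnertonDyer.BirchSwinnertonDyer.Theorems.SchneiderFree.BranchInducesPrime 3 ι' 𝔭 → ∀ (ΩK : ℂ)
      (Ωp : ℂ_[3]) (L : Literature.NumberTheory.EllipticCurves.UnrSeries 3), ΩK ≠ 0 → Ωp ≠ 0 →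
      Literature.NumberTheory.EllipticCurves.IsBDPLFunction ι' 𝔭 κ γ Dt.f ΩK Ωp L → ∀ (ΩK' : ℂ) (Ωp' : ℂ_[3]) (L'
      : Literature.NumberTheory.EllipticCurves.UnrSeries 3), ΩK' ≠ 0 → Ωp' ≠ 0 →
      Literature.NumberTheory.EllipticCurves.IsBDPLFunction ι' 𝔭 κ γ Dt'.f ΩK' Ωp' L' → (∃ i : ℕ,
      ‖((PowerSeries.coeff i L' : Literature.NumberTheory.EllipticCurves.unrIntegers 3) : ℂ_[3])‖ = 1) → ∀ (T :
      Finset (IsDedekindDomain.HeightOneSpectrum (NumberField.RingOfIntegers K))) (c :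
      IsDedekindDomain.HeightOneSpectrum (NumberField.RingOfIntegers K) → ℕ), (↑T = {v :
      IsDedekindDomain.HeightOneSpectrum (NumberField.RingOfIntegers K) | ((3 : ℕ) : NumberField.RingOfIntegers K)
      ∉ v.asIdeal ∧ (¬ (W.baseChange K).HasGoodReductionAt v ∨ ¬ (W'.baseChange K).HasGoodReductionAt v)}) → (∀ v
      ∈ T, (∃ d₀ : Literature.NumberTheory.EllipticCurves.GreenbergSelmer.decomp (K := K) v, (κ (d₀ :
      Field.absoluteGaloisGroup K)).toAdd = (3 : ℤ_[3]) ^ c v) ∧ (∀ d :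
      Literature.NumberTheory.EllipticCurves.GreenbergSelmer.decomp (K := K) v, (3 : ℤ_[3]) ^ c v ∣ (κ (d :
      Field.absoluteGaloisGroup K)).toAdd)) →
      ∃ (Θ : (ℕ → ℤ) →+ Literature.NumberTheory.EllipticCurves.UnrSeries 3)
        (e : IsDedekindDomain.HeightOneSpectrum (NumberField.RingOfIntegers K) → ℤ_[3]),
        (∀ v ∈ T, e v ≠ 0 ∧ (e v).valuation = c v) ∧
        (∃ (a b : Literature.NumberTheory.EllipticCurves.unrIntegers 3)
            (w : Literature.NumberTheory.EllipticCurves.UnrSeries 3), a ≠ 0 ∧ b ≠ 0 ∧ IsUnit w ∧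
          PowerSeries.C a * (L * PowerSeries.map (Summit.BirchSwinnertonDyer.Rank1Residual.X11b.Halves.toUnr 3)
            (∏ v ∈ T, (Polynomial.aeval
              (PowerSeries.C ((Nat.card (IsLocalRing.ResidueField (v.adicCompletionIntegers K)) : ℤ_[3]).inv) *
                PowerSeries.binomialSeries ℤ_[3] (e v)) ((W.baseChange K).localPolynomialAt v) :
              Literature.NumberTheory.EllipticCurves.IwasawaAlgebra 3))) =
          PowerSeries.C b * (w * Θ (fun n : ℕ ↦ if Nat.Coprime n (3 * (N * N')) then W.LFunction n else 0) ^ 2)) ∧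
        (∃ (a' b' : Literature.NumberTheory.EllipticCurves.unrIntegers 3)
            (w' : Literature.NumberTheory.EllipticCurves.UnrSeries 3), a' ≠ 0 ∧ b' ≠ 0 ∧ IsUnit w' ∧
          PowerSeries.C a' * (L' * PowerSeries.map (Summit.BirchSwinnertonDyer.Rank1Residual.X11b.Halves.toUnr 3)
            (∏ v ∈ T, (Polynomial.aeval
              (PowerSeries.C ((Nat.card (IsLocalRing.ResidueField (v.adicCompletionIntegers K)) : ℤ_[3]).inv) *
                PowerSeries.binomialSeries ℤ_[3] (e v)) ((W'.baseChange K).localPolynomialAt v) :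
              Literature.NumberTheory.EllipticCurves.IwasawaAlgebra 3))) =
          PowerSeries.C b' * (w' * Θ (fun n : ℕ ↦ if Nat.Coprime n (3 * (N * N')) then W'.LFunction n else 0) ^ 2)) ∧
        (∃ i : ℕ, ‖((PowerSeries.coeff i (Θ (fun n : ℕ ↦ if Nat.Coprime n (3 * (N * N')) then W'.LFunction n else 0)) :
          Literature.NumberTheory.EllipticCurves.unrIntegers 3) : ℂ_[3])‖ = 1)

/-- **F♭^{div} `DivisibleSquareRootPair`** — g9's F♭ (`CongruentSquareRootPair`, §3) with its congruence clause
`∀ i, ‖[Tⁱ](Y − Y′)‖ < 1` replaced by DIVISIBLE CONGRUENCE TO THE DEPTH OF THE `q`-EXPANSION CONGRUENCE: for every `k`,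
if `3^k` divides every depleted coefficient difference `a_n(E) − a_n(E′)`, `(n, 3NN′) = 1`, then `3^k ∣ Y − Y′` in
`R₀⟦T⟧`.  No functional, no moments.  Tag: ≡ F (kernel, §2); ⟹ F♭ given H (kernel, §3); = «A ∧ Sq_E ∧ Sq_{E′}» at depth
`k_Σ = 1` (paper, memo §3). [cite: GreenbergVatsal2000, Thm. (1.5)] [cite: Hsieh2014, Thm. A, Prop. 3.5] -/
def DivisibleSquareRootPair : Prop :=
      ∀ (W : WeierstrassCurve ℚ) [W.IsElliptic] [W.IsGloballyMinimal] (W' : WeierstrassCurve ℚ) [W'.IsElliptic]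
      [W'.IsGloballyMinimal] (N N' : ℕ) [NeZero N] [NeZero N'] (K : Type) [Field K] [NumberField K] (Dt :
      Literature.NumberTheory.EllipticCurves.ModularForms.ModularParametrizationData W N) (Dt' :
      Literature.NumberTheory.EllipticCurves.ModularForms.ModularParametrizationData W' N'),
      Summit.BirchSwinnertonDyer.Rank1Residual.Additive.ClassO6 W 3 → W.HasSurjectiveModNGaloisRep 3 →
      W.analyticRank = 1 → W.conductorNorm ℤ = N → Summit.BirchSwinnertonDyer.Rank1Residual.O6.ModPCongruent W' W
      3 → ¬ Literature.NumberTheory.EllipticCurves.Rank1Residual.Addv W' 3 → W'.conductorNorm ℤ = N' →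
      Literature.NumberTheory.EllipticCurves.IsImaginaryQuadratic K →
      Literature.NumberTheory.EllipticCurves.SatisfiesHeegnerHypothesis N K →
      Literature.NumberTheory.EllipticCurves.SatisfiesHeegnerHypothesis N' K → ∀ (κ :
      Literature.NumberTheory.EllipticCurves.ZpExtension K 3), κ.IsAnticyclotomic → ∀ (γ :
      Field.absoluteGaloisGroup K) [Fact (κ.IsTopGenerator γ)] (𝔭 : IsDedekindDomain.HeightOneSpectrum
      (NumberField.RingOfIntegers K)), ((3 : ℕ) : NumberField.RingOfIntegers K) ∈ 𝔭.asIdeal →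
      𝔭.asIdeal.ramificationIdx (NumberField.RingOfIntegers ℚ) = 1 → 𝔭.asIdeal.inertiaDeg
      (NumberField.RingOfIntegers ℚ) = 1 → ∀ (𝔭' : IsDedekindDomain.HeightOneSpectrum (NumberField.RingOfIntegers
      K)), ((3 : ℕ) : NumberField.RingOfIntegers K) ∈ 𝔭'.asIdeal → 𝔭' ≠ 𝔭 → ∀ (ι' : PadicAlgCl 3 ≃+* ℂ),
      Summit.BirchSwinnertonDyer.BirchSwinnertonDyer.Theorems.SchneiderFree.BranchInducesPrime 3 ι' 𝔭 → ∀ (ΩK : ℂ)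
      (Ωp : ℂ_[3]) (L : Literature.NumberTheory.EllipticCurves.UnrSeries 3), ΩK ≠ 0 → Ωp ≠ 0 →
      Literature.NumberTheory.EllipticCurves.IsBDPLFunction ι' 𝔭 κ γ Dt.f ΩK Ωp L → ∀ (ΩK' : ℂ) (Ωp' : ℂ_[3]) (L'
      : Literature.NumberTheory.EllipticCurves.UnrSeries 3), ΩK' ≠ 0 → Ωp' ≠ 0 →
      Literature.NumberTheory.EllipticCurves.IsBDPLFunction ι' 𝔭 κ γ Dt'.f ΩK' Ωp' L' → (∃ i : ℕ,
      ‖((PowerSeries.coeff i L' : Literature.NumberTheory.EllipticCurves.unrIntegers 3) : ℂ_[3])‖ = 1) → ∀ (T :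
      Finset (IsDedekindDomain.HeightOneSpectrum (NumberField.RingOfIntegers K))) (c :
      IsDedekindDomain.HeightOneSpectrum (NumberField.RingOfIntegers K) → ℕ), (↑T = {v :
      IsDedekindDomain.HeightOneSpectrum (NumberField.RingOfIntegers K) | ((3 : ℕ) : NumberField.RingOfIntegers K)
      ∉ v.asIdeal ∧ (¬ (W.baseChange K).HasGoodReductionAt v ∨ ¬ (W'.baseChange K).HasGoodReductionAt v)}) → (∀ v
      ∈ T, (∃ d₀ : Literature.NumberTheory.EllipticCurves.GreenbergSelmer.decomp (K := K) v, (κ (d₀ :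
      Field.absoluteGaloisGroup K)).toAdd = (3 : ℤ_[3]) ^ c v) ∧ (∀ d :
      Literature.NumberTheory.EllipticCurves.GreenbergSelmer.decomp (K := K) v, (3 : ℤ_[3]) ^ c v ∣ (κ (d :
      Field.absoluteGaloisGroup K)).toAdd)) →
      ∃ (e : IsDedekindDomain.HeightOneSpectrum (NumberField.RingOfIntegers K) → ℤ_[3])
        (Y Y' : Literature.NumberTheory.EllipticCurves.UnrSeries 3),
        (∀ v ∈ T, e v ≠ 0 ∧ (e v).valuation = c v) ∧
        (∀ k : ℕ, (∀ n : ℕ, (3 : ℤ) ^ k ∣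
            ((if Nat.Coprime n (3 * (N * N')) then W.LFunction n else 0) -
              (if Nat.Coprime n (3 * (N * N')) then W'.LFunction n else 0))) →
          ∃ Z : Literature.NumberTheory.EllipticCurves.UnrSeries 3,
            Y - Y' = (3 : Literature.NumberTheory.EllipticCurves.UnrSeries 3) ^ k * Z) ∧
        (∃ (a b : Literature.NumberTheory.EllipticCurves.unrIntegers 3)
            (w : Literature.NumberTheory.EllipticCurves.UnrSeries 3), a ≠ 0 ∧ b ≠ 0 ∧ IsUnit w ∧
          PowerSeries.C a * (L * PowerSeries.map (Summit.BirchSwinnertonDyer.Rank1Residual.X11b.Halves.toUnr 3)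
            (∏ v ∈ T, (Polynomial.aeval
              (PowerSeries.C ((Nat.card (IsLocalRing.ResidueField (v.adicCompletionIntegers K)) : ℤ_[3]).inv) *
                PowerSeries.binomialSeries ℤ_[3] (e v)) ((W.baseChange K).localPolynomialAt v) :
              Literature.NumberTheory.EllipticCurves.IwasawaAlgebra 3))) =
          PowerSeries.C b * (w * Y ^ 2)) ∧
        (∃ (a' b' : Literature.NumberTheory.EllipticCurves.unrIntegers 3)
            (w' : Literature.NumberTheory.EllipticCurves.UnrSeries 3), a' ≠ 0 ∧ b' ≠ 0 ∧ IsUnit w' ∧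
          PowerSeries.C a' * (L' * PowerSeries.map (Summit.BirchSwinnertonDyer.Rank1Residual.X11b.Halves.toUnr 3)
            (∏ v ∈ T, (Polynomial.aeval
              (PowerSeries.C ((Nat.card (IsLocalRing.ResidueField (v.adicCompletionIntegers K)) : ℤ_[3]).inv) *
                PowerSeries.binomialSeries ℤ_[3] (e v)) ((W'.baseChange K).localPolynomialAt v) :
              Literature.NumberTheory.EllipticCurves.IwasawaAlgebra 3))) =
          PowerSeries.C b' * (w' * Y' ^ 2)) ∧
        (∃ i : ℕ, ‖((PowerSeries.coeff i Y' :
          Literature.NumberTheory.EllipticCurves.unrIntegers 3) : ℂ_[3])‖ = 1)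

/-- `g_E(1) = 1`: the depleted eigen-sequence has first coefficient `a_1(E) = 1`. [folklore] -/
theorem depleted_apply_one (W : WeierstrassCurve ℚ) [W.IsElliptic] (M : ℕ) :
    (fun n : ℕ ↦ if Nat.Coprime n M then W.LFunction n else 0) 1 = 1 := by
  simp [W.LFunction_apply_one]

/-- **F ⟺ F♭^{div} (PROVED, both directions, on A's binders).**  (⟹) `Y := Θ g_E`, `Y′ := Θ g_{E′}` and additivity
(`forall_exists_of_addMonoidHom`); (⟸) the free-functional lemma `exists_addMonoidHom_apply_eq` with `n₁ = 1`
(`a_1 = 1`).  So the line's "ONE additive square-root toric functional" carries exactly the content of the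
functional-free pair statement F♭^{div}: the functional is a free ∃-witness (degenerate-witness pass, checklist 4c (iv)).
[folklore] -/
theorem sqrtToricFunctional_iff_divisibleSquareRootPair : SqrtToricFunctional ↔ DivisibleSquareRootPair := by
  constructor
  · intro hF W _ _ W' _ _ N N' _ _ K _ _ Dt Dt' hO6 hsurj hrk hN hmod haddv hN' hK hH hH' κ hκ γ _ 𝔭 h𝔭 hram
        hdeg 𝔭' h𝔭' hne ι' hι ΩK Ωp L hΩK hΩp hL ΩK' Ωp' L' hΩK' hΩp' hL' hi' T c hT hc
    obtain ⟨Θ, e, he, hwild, htwin, hμ'⟩ :=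
      hF W W' N N' K Dt Dt' hO6 hsurj hrk hN hmod haddv hN' hK hH hH' κ hκ γ 𝔭 h𝔭 hram hdeg 𝔭' h𝔭' hne ι' hι ΩK Ωp
        L hΩK hΩp hL ΩK' Ωp' L' hΩK' hΩp' hL' hi' T c hT hc
    refine ⟨e, Θ (fun n : ℕ ↦ if Nat.Coprime n (3 * (N * N')) then W.LFunction n else 0),
      Θ (fun n : ℕ ↦ if Nat.Coprime n (3 * (N * N')) then W'.LFunction n else 0), he, ?_, hwild, htwin, hμ'⟩
    intro k hk
    exact forall_exists_of_addMonoidHom Θ _ _ k hk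
  · intro hD W _ _ W' _ _ N N' _ _ K _ _ Dt Dt' hO6 hsurj hrk hN hmod haddv hN' hK hH hH' κ hκ γ _ 𝔭 h𝔭 hram
        hdeg 𝔭' h𝔭' hne ι' hι ΩK Ωp L hΩK hΩp hL ΩK' Ωp' L' hΩK' hΩp' hL' hi' T c hT hc
    obtain ⟨e, Y, Y', he, hdiv, hwild, htwin, hμ'⟩ :=
      hD W W' N N' K Dt Dt' hO6 hsurj hrk hN hmod haddv hN' hK hH hH' κ hκ γ 𝔭 h𝔭 hram hdeg 𝔭' h𝔭' hne ι' hι ΩK Ωp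
        L hΩK hΩp hL ΩK' Ωp' L' hΩK' hΩp' hL' hi' T c hT hc
    obtain ⟨Θ, hΘ, hΘ'⟩ := exists_addMonoidHom_apply_eq
      (g := fun n : ℕ ↦ if Nat.Coprime n (3 * (N * N')) then W.LFunction n else 0)
      (g' := fun n : ℕ ↦ if Nat.Coprime n (3 * (N * N')) then W'.LFunction n else 0)
      (n₁ := 1) (depleted_apply_one W _) (depleted_apply_one W' _) hdiv
    refine ⟨Θ, e, he, ?_, ?_, ?_⟩
    · rw [hΘ]; exact hwild
    · rw [hΘ']; exact htwin
    · rw [hΘ']; exact hμ'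

/-- **The (wild)/(twin) clause pins its square root only up to a unit of `R₀⟦T⟧` (PROVED).**  If
`C a · X = C b · (w · Y²)` with `w` a unit, then for ANY unit `s` also `C a · X = C b · (w′ · (s·Y)²)` with the unit
`w′ := w · s⁻²`.  With §2 this is the second half of the witness audit: in F♭ the series `Y, Y′` are determined by
(wild)/(twin) only up to `R₀⟦T⟧ˣ`, so F♭'s congruence clause `Y ≡ Y′ (mod 𝔪)` says exactly "the two depleted frames are
congruent up to a unit `mod 𝔪`" = A's conclusion, conjoined with the squareness of each frame (memo §3 (b); the
remaining step — a unit of `k⟦T⟧`, `k = R₀/𝔪` algebraically closed of characteristic `3`, is a square — is paper-only: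
the tree has neither the residue field of `unrIntegers 3` nor square roots of power series). [folklore] -/
theorem frame_eq_of_isUnit_mul {X Y w s : UnrSeries 3} {a b : unrIntegers 3} (hw : IsUnit w) (hs : IsUnit s)
    (h : PowerSeries.C a * X = PowerSeries.C b * (w * Y ^ 2)) :
    ∃ w' : UnrSeries 3, IsUnit w' ∧ PowerSeries.C a * X = PowerSeries.C b * (w' * (s * Y) ^ 2) := by
  obtain ⟨t, rfl⟩ := hs
  refine ⟨w * ↑(t⁻¹ ^ 2), hw.mul (Units.isUnit _), ?_⟩
  have key : ((↑(t⁻¹ ^ 2) : UnrSeries 3)) * (↑t : UnrSeries 3) ^ 2 = 1 := by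
    rw [inv_pow, ← Units.val_pow_eq_pow_val, Units.inv_mul]
  calc PowerSeries.C a * X = PowerSeries.C b * (w * Y ^ 2) := h
    _ = PowerSeries.C b * (w * (((↑(t⁻¹ ^ 2) : UnrSeries 3)) * (↑t : UnrSeries 3) ^ 2) * Y ^ 2) := by
        rw [key, mul_one]
    _ = PowerSeries.C b * (w * ↑(t⁻¹ ^ 2) * (↑t * Y) ^ 2) := by ring

/-! ### §3 F♭ (g9, copied verbatim), H (the line's stub, copied); F♭^{div} ∧ H ⟹ F♭; compositions to A BY NAME -/

/-- **F♭ `CongruentSquareRootPair`** — copied VERBATIM from node `HeckeDualElement` (g9) §2 = node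
`ClassicalMomentAvatar` (g10) §3 (Cruxes modules are not built, so they cannot be imported): exponents `e_v ≠ 0` of
valuation `c_v`, two series `Y, Y′ ∈ R₀⟦T⟧` congruent `mod 𝔪_{R₀}` coefficientwise, (wild), (twin), (μ′).
Tag (pool): TRANSFER · STRONGER than A · UNDECIDED; tag (this node, memo §3): = «A ∧ Sq_E ∧ Sq_{E′}» (paper).
[cite: Hsieh2014, Thm. A, Prop. 3.5] [cite: KrizLi2019, Def. 3.1–3.2] -/
def CongruentSquareRootPair : Prop :=
      ∀ (W : WeierstrassCurve ℚ) [W.IsElliptic] [W.IsGloballyMinimal] (W' : WeierstrassCurve ℚ) [W'.IsElliptic]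
      [W'.IsGloballyMinimal] (N N' : ℕ) [NeZero N] [NeZero N'] (K : Type) [Field K] [NumberField K] (Dt :
      Literature.NumberTheory.EllipticCurves.ModularForms.ModularParametrizationData W N) (Dt' :
      Literature.NumberTheory.EllipticCurves.ModularForms.ModularParametrizationData W' N'),
      Summit.BirchSwinnertonDyer.Rank1Residual.Additive.ClassO6 W 3 → W.HasSurjectiveModNGaloisRep 3 →
      W.analyticRank = 1 → W.conductorNorm ℤ = N → Summit.BirchSwinnertonDyer.Rank1Residual.O6.ModPCongruent W' W
      3 → ¬ Literature.NumberTheory.EllipticCurves.Rank1Residual.Addv W' 3 → W'.conductorNorm ℤ = N' →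
      Literature.NumberTheory.EllipticCurves.IsImaginaryQuadratic K →
      Literature.NumberTheory.EllipticCurves.SatisfiesHeegnerHypothesis N K →
      Literature.NumberTheory.EllipticCurves.SatisfiesHeegnerHypothesis N' K → ∀ (κ :
      Literature.NumberTheory.EllipticCurves.ZpExtension K 3), κ.IsAnticyclotomic → ∀ (γ :
      Field.absoluteGaloisGroup K) [Fact (κ.IsTopGenerator γ)] (𝔭 : IsDedekindDomain.HeightOneSpectrum
      (NumberField.RingOfIntegers K)), ((3 : ℕ) : NumberField.RingOfIntegers K) ∈ 𝔭.asIdeal →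
      𝔭.asIdeal.ramificationIdx (NumberField.RingOfIntegers ℚ) = 1 → 𝔭.asIdeal.inertiaDeg
      (NumberField.RingOfIntegers ℚ) = 1 → ∀ (𝔭' : IsDedekindDomain.HeightOneSpectrum (NumberField.RingOfIntegers
      K)), ((3 : ℕ) : NumberField.RingOfIntegers K) ∈ 𝔭'.asIdeal → 𝔭' ≠ 𝔭 → ∀ (ι' : PadicAlgCl 3 ≃+* ℂ),
      Summit.BirchSwinnertonDyer.BirchSwinnertonDyer.Theorems.SchneiderFree.BranchInducesPrime 3 ι' 𝔭 → ∀ (ΩK : ℂ)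
      (Ωp : ℂ_[3]) (L : Literature.NumberTheory.EllipticCurves.UnrSeries 3), ΩK ≠ 0 → Ωp ≠ 0 →
      Literature.NumberTheory.EllipticCurves.IsBDPLFunction ι' 𝔭 κ γ Dt.f ΩK Ωp L → ∀ (ΩK' : ℂ) (Ωp' : ℂ_[3]) (L'
      : Literature.NumberTheory.EllipticCurves.UnrSeries 3), ΩK' ≠ 0 → Ωp' ≠ 0 →
      Literature.NumberTheory.EllipticCurves.IsBDPLFunction ι' 𝔭 κ γ Dt'.f ΩK' Ωp' L' → (∃ i : ℕ,
      ‖((PowerSeries.coeff i L' : Literature.NumberTheory.EllipticCurves.unrIntegers 3) : ℂ_[3])‖ = 1) → ∀ (T :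
      Finset (IsDedekindDomain.HeightOneSpectrum (NumberField.RingOfIntegers K))) (c :
      IsDedekindDomain.HeightOneSpectrum (NumberField.RingOfIntegers K) → ℕ), (↑T = {v :
      IsDedekindDomain.HeightOneSpectrum (NumberField.RingOfIntegers K) | ((3 : ℕ) : NumberField.RingOfIntegers K)
      ∉ v.asIdeal ∧ (¬ (W.baseChange K).HasGoodReductionAt v ∨ ¬ (W'.baseChange K).HasGoodReductionAt v)}) → (∀ v
      ∈ T, (∃ d₀ : Literature.NumberTheory.EllipticCurves.GreenbergSelmer.decomp (K := K) v, (κ (d₀ :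
      Field.absoluteGaloisGroup K)).toAdd = (3 : ℤ_[3]) ^ c v) ∧ (∀ d :
      Literature.NumberTheory.EllipticCurves.GreenbergSelmer.decomp (K := K) v, (3 : ℤ_[3]) ^ c v ∣ (κ (d :
      Field.absoluteGaloisGroup K)).toAdd)) →
      ∃ (e : IsDedekindDomain.HeightOneSpectrum (NumberField.RingOfIntegers K) → ℤ_[3])
        (Y Y' : Literature.NumberTheory.EllipticCurves.UnrSeries 3),
        (∀ v ∈ T, e v ≠ 0 ∧ (e v).valuation = c v) ∧
        (∀ i : ℕ, ‖((PowerSeries.coeff i (Y - Y') :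
          Literature.NumberTheory.EllipticCurves.unrIntegers 3) : ℂ_[3])‖ < 1) ∧
        (∃ (a b : Literature.NumberTheory.EllipticCurves.unrIntegers 3)
            (w : Literature.NumberTheory.EllipticCurves.UnrSeries 3), a ≠ 0 ∧ b ≠ 0 ∧ IsUnit w ∧
          PowerSeries.C a * (L * PowerSeries.map (Summit.BirchSwinnertonDyer.Rank1Residual.X11b.Halves.toUnr 3)
            (∏ v ∈ T, (Polynomial.aeval
              (PowerSeries.C ((Nat.card (IsLocalRing.ResidueField (v.adicCompletionIntegers K)) : ℤ_[3]).inv) *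
                PowerSeries.binomialSeries ℤ_[3] (e v)) ((W.baseChange K).localPolynomialAt v) :
              Literature.NumberTheory.EllipticCurves.IwasawaAlgebra 3))) =
          PowerSeries.C b * (w * Y ^ 2)) ∧
        (∃ (a' b' : Literature.NumberTheory.EllipticCurves.unrIntegers 3)
            (w' : Literature.NumberTheory.EllipticCurves.UnrSeries 3), a' ≠ 0 ∧ b' ≠ 0 ∧ IsUnit w' ∧
          PowerSeries.C a' * (L' * PowerSeries.map (Summit.BirchSwinnertonDyer.Rank1Residual.X11b.Halves.toUnr 3)
            (∏ v ∈ T, (Polynomial.aeval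
              (PowerSeries.C ((Nat.card (IsLocalRing.ResidueField (v.adicCompletionIntegers K)) : ℤ_[3]).inv) *
                PowerSeries.binomialSeries ℤ_[3] (e v)) ((W'.baseChange K).localPolynomialAt v) :
              Literature.NumberTheory.EllipticCurves.IwasawaAlgebra 3))) =
          PowerSeries.C b' * (w' * Y' ^ 2)) ∧
        (∃ i : ℕ, ‖((PowerSeries.coeff i Y' :
          Literature.NumberTheory.EllipticCurves.unrIntegers 3) : ℂ_[3])‖ = 1)

/-- **H = the line's stub `stub_heckeCongruence`** (ll. 77–81, statement copied VERBATIM as a `Prop`): for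
`3`-congruent `E′ ∼ E`, `a_n(E) ≡ a_n(E′) (mod 3)` for every `n` prime to `3NN′`.  Tag: WEAKER than A · ATTACKABLE (M).
[cite: SilvermanAEC2009, C.21 Remark 21.3] [cite: DiamondShurman2005, Prop. 5.8.5] -/
def HeckeCongruenceDepleted : Prop :=
      ∀ (W : WeierstrassCurve ℚ) [W.IsElliptic] [W.IsGloballyMinimal] (W' : WeierstrassCurve ℚ) [W'.IsElliptic]
      [W'.IsGloballyMinimal] (N N' : ℕ), W.conductorNorm ℤ = N → W'.conductorNorm ℤ = N' →
      Summit.BirchSwinnertonDyer.Rank1Residual.O6.ModPCongruent W' W 3 →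
      ∀ n : ℕ, Nat.Coprime n (3 * (N * N')) → (3 : ℤ) ∣ W.LFunction n - W'.LFunction n

/-- **F♭^{div} ∧ H ⟹ F♭ (PROVED).**  At depth `k = 1` the Hecke congruence makes every depleted coefficient difference
divisible by `3`, so `Y − Y′ = 3·Z` and every coefficient of `Y − Y′` has norm `≤ ‖3‖ < 1`. [folklore] -/
theorem congruentSquareRootPair_of_divisible (hHecke : HeckeCongruenceDepleted) (hD : DivisibleSquareRootPair) :
    CongruentSquareRootPair := by
  intro W _ _ W' _ _ N N' _ _ K _ _ Dt Dt' hO6 hsurj hrk hN hmod haddv hN' hK hH hH' κ hκ γ _ 𝔭 h𝔭 hram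
      hdeg 𝔭' h𝔭' hne ι' hι ΩK Ωp L hΩK hΩp hL ΩK' Ωp' L' hΩK' hΩp' hL' hi' T c hT hc
  obtain ⟨e, Y, Y', he, hdiv, hwild, htwin, hμ'⟩ :=
    hD W W' N N' K Dt Dt' hO6 hsurj hrk hN hmod haddv hN' hK hH hH' κ hκ γ 𝔭 h𝔭 hram hdeg 𝔭' h𝔭' hne ι' hι ΩK Ωp
      L hΩK hΩp hL ΩK' Ωp' L' hΩK' hΩp' hL' hi' T c hT hc
  have hk1 : ∀ n : ℕ, (3 : ℤ) ^ 1 ∣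
      ((if Nat.Coprime n (3 * (N * N')) then W.LFunction n else 0) -
        (if Nat.Coprime n (3 * (N * N')) then W'.LFunction n else 0)) := by
    intro n
    by_cases hn : Nat.Coprime n (3 * (N * N'))
    · rw [if_pos hn, if_pos hn, pow_one]
      exact hHecke W W' N N' hN hN' hmod n hn
    · rw [if_neg hn, if_neg hn, sub_self]
      exact dvd_zero _
  obtain ⟨Z, hZ⟩ := hdiv 1 hk1
  refine ⟨e, Y, Y', he, fun i ↦ ?_, hwild, htwin, hμ'⟩
  rw [hZ, pow_one, three_eq_C, PowerSeries.coeff_C_mul]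
  exact norm_three_mul_lt_one _

/-- Two non-zero constant multiples of series with norm profiles `M, M′` are equal only if `M = M′` (copied from node
`HeckeDualElement` §4 / the line `SqrtToricFunctional.profile_eq_of_C_mul_eq`; constants are never compared with
units). [cite: Washington1997, §7.1] -/
theorem profile_eq_of_C_mul_eq {X Y : UnrSeries 3} {a b : unrIntegers 3} {M M' : ℕ} (ha : a ≠ 0) (hb : b ≠ 0)
    (hX : (∀ i < M, ‖((PowerSeries.coeff i X : unrIntegers 3) : ℂ_[3])‖ < 1) ∧
      ‖((PowerSeries.coeff M X : unrIntegers 3) : ℂ_[3])‖ = 1)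
    (hY : (∀ i < M', ‖((PowerSeries.coeff i Y : unrIntegers 3) : ℂ_[3])‖ < 1) ∧
      ‖((PowerSeries.coeff M' Y : unrIntegers 3) : ℂ_[3])‖ = 1)
    (h : PowerSeries.C a * X = PowerSeries.C b * Y) : M = M' := by
  have key : ∀ i, ‖(a : ℂ_[3])‖ * ‖((PowerSeries.coeff i X : unrIntegers 3) : ℂ_[3])‖ =
      ‖(b : ℂ_[3])‖ * ‖((PowerSeries.coeff i Y : unrIntegers 3) : ℂ_[3])‖ := by
    intro i
    have hi := congrArg (PowerSeries.coeff i) h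
    simp only [PowerSeries.coeff_C_mul] at hi
    have hi' := congrArg (fun z : unrIntegers 3 ↦ ‖(z : ℂ_[3])‖) hi
    simpa only [Subring.coe_mul, norm_mul] using hi'
  have ha' : 0 < ‖(a : ℂ_[3])‖ := norm_pos_iff.mpr (by simpa using ha)
  have hb' : 0 < ‖(b : ℂ_[3])‖ := norm_pos_iff.mpr (by simpa using hb)
  rcases lt_trichotomy M M' with hlt | heq | hgt
  · exfalso
    have h1 := key M
    have h2 := key M'
    rw [hX.2, mul_one] at h1
    rw [hY.2, mul_one] at h2
    have hab : ‖(a : ℂ_[3])‖ < ‖(b : ℂ_[3])‖ := by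
      rw [h1]; exact mul_lt_of_lt_one_right hb' (hY.1 M hlt)
    have hba : ‖(b : ℂ_[3])‖ ≤ ‖(a : ℂ_[3])‖ := by
      rw [← h2]; exact mul_le_of_le_one_right ha'.le (norm_coeff_le_one X M')
    exact absurd hab (not_lt.mpr hba)
  · exact heq
  · exfalso
    have h1 := key M'
    have h2 := key M
    rw [hY.2, mul_one] at h1
    rw [hX.2, mul_one] at h2
    have hba : ‖(b : ℂ_[3])‖ < ‖(a : ℂ_[3])‖ := by
      rw [← h1]; exact mul_lt_of_lt_one_right ha' (hX.1 M' hgt)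
    have hab : ‖(a : ℂ_[3])‖ ≤ ‖(b : ℂ_[3])‖ := by
      rw [h2]; exact mul_le_of_le_one_right hb'.le (norm_coeff_le_one Y M)
    exact absurd hba (not_lt.mpr hab)

/-- **F♭ ⟹ A given Thm. B (PROVED; A concluded BY NAME)** — copied verbatim from node `HeckeDualElement` §4 (g9):
rewrite A as the λ-identity (p705895 §5); `𝓛·Π_E(e)` has profile `m + D`, `𝓛′·Π_{E′}(e)` profile `m′ + D′` (p615705);
`Y′` has a profile `f′` (μ′), `Y ≡ Y′` so `Y` has profile `f′`; `w·Y²`, `w′·Y′²` have profile `2f′`; (wild)/(twin)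
force `m + D = 2f′ = m′ + D′`. -/
theorem sigmaCongruenceAtThree_of_congruentSquareRootPair
    (hB : Literature.NumberTheory.EllipticCurves.Hsieh2014.thmB_exists_isHsiehLFunction_coeff_norm_eq_one_unrPeriod_anyLevel)
    (hF : CongruentSquareRootPair) : SigmaCongruenceAtThree := by
  haveI : Fact (Nat.Prime 3) := ⟨Nat.prime_three⟩
  rw [UniversalToricDescentSigmaCongruenceInvariantPair.sigmaCongruenceAtThree_iff_lambdaIdentity_of_thmB hB]
  intro W _ _ W' _ _ N N' _ _ K _ _ Dt Dt' hO6 hsurj hrk hN hmod haddv hN' hK hH hH' κ hκ γ _ 𝔭 h𝔭 hram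
      hdeg 𝔭' h𝔭' hne ι' hι ΩK Ωp L hΩK hΩp hL ΩK' Ωp' L' hΩK' hΩp' hL' hi' T c hT hc m m' hm hm'
  obtain ⟨e, Y, Y', he, hcongr, ⟨a, b, w, ha, hb, hw, hEq⟩, ⟨a', b', w', ha', hb', hw', hEq'⟩, hi0'⟩ :=
    hF W W' N N' K Dt Dt' hO6 hsurj hrk hN hmod haddv hN' hK hH hH' κ hκ γ 𝔭 h𝔭 hram hdeg 𝔭' h𝔭' hne ι' hι ΩK Ωp L
      hΩK hΩp hL ΩK' Ωp' L' hΩK' hΩp' hL' hi' T c hT hc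
  have hT3 := UniversalToricDescentSigmaCongruenceInvariantPair.not_mem_of_coe_eq hT
  obtain ⟨-, hordE⟩ := order_map_toZMod_prod_aeval_localPolynomialAt (W.baseChange K) T hT3 e
    (fun v hv ↦ (he v hv).1)
  obtain ⟨-, hordE'⟩ := order_map_toZMod_prod_aeval_localPolynomialAt (W'.baseChange K) T hT3 e
    (fun v hv ↦ (he v hv).1)
  have hX := normProfile_mul hm (normProfile_map_toUnr_of_order_eq _ hordE)
  have hX' := normProfile_mul hm' (normProfile_map_toUnr_of_order_eq _ hordE')
  obtain ⟨f', hF'⟩ := UniversalToricDescentSelfMuZero.exists_normProfile_of_exists_coeff_norm_eq_one hi0'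
  have hFY := normProfile_of_forall_norm_sub_lt hcongr hF'
  have hF2 := normProfile_mul hFY hFY
  have hF2' := normProfile_mul hF' hF'
  rw [← sq] at hF2 hF2'
  have hwF2 := normProfile_mul_of_isUnit hw hF2
  have hwF2' := normProfile_mul_of_isUnit hw' hF2'
  have h1 := profile_eq_of_C_mul_eq ha hb hX hwF2 hEq
  have h2 := profile_eq_of_C_mul_eq ha' hb' hX' hwF2' hEq'
  have key : ∀ E : WeierstrassCurve K,
      ∑ v ∈ T, (eulerFactorModP E 3 v).rootMultiplicity
            (((Nat.card (IsLocalRing.ResidueField (v.adicCompletionIntegers K)) : ℕ) : ZMod 3)⁻¹) *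
          3 ^ (e v).valuation =
        ∑ v ∈ T, 3 ^ c v * (eulerFactorModP E 3 v).rootMultiplicity
            (((Nat.card (IsLocalRing.ResidueField (v.adicCompletionIntegers K)) : ℕ) : ZMod 3)⁻¹) :=
    fun E ↦ Finset.sum_congr rfl fun v hv ↦ by rw [(he v hv).2, mul_comm]
  rw [← key, ← key]
  omega

/-- **F♭^{div} ⟹ A given Thm. B and H (PROVED composition), A BY NAME.** -/
theorem sigmaCongruenceAtThree_of_divisibleSquareRootPair
    (hB : Literature.NumberTheory.EllipticCurves.Hsieh2014.thmB_exists_isHsiehLFunction_coeff_norm_eq_one_unrPeriod_anyLevel)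
    (hHecke : HeckeCongruenceDepleted) (hD : DivisibleSquareRootPair) : SigmaCongruenceAtThree :=
  sigmaCongruenceAtThree_of_congruentSquareRootPair hB (congruentSquareRootPair_of_divisible hHecke hD)

/-- **The line's deciding composition RE-FACTORED through the functional-free F♭ (PROVED), A BY NAME:**
`hB → H → F → A` is `hB → H → (F ⟺ F♭^{div}) → F♭ → A` — the additive functional `Θ` of stub F is never used as a
functional. -/
theorem sigmaCongruenceAtThree_of_sqrtToricFunctional
    (hB : Literature.NumberTheory.EllipticCurves.Hsieh2014.thmB_exists_isHsiehLFunction_coeff_norm_eq_one_unrPeriod_anyLevel)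
    (hHecke : HeckeCongruenceDepleted) (hF : SqrtToricFunctional) : SigmaCongruenceAtThree :=
  sigmaCongruenceAtThree_of_divisibleSquareRootPair hB hHecke (sqrtToricFunctional_iff_divisibleSquareRootPair.mp hF)

end Summit.BirchSwinnertonDyer.BirchSwinnertonDyer.Cruxes.SigmaCongruenceAtThree.TransferWitnessAudit

end
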